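import Summits.ResolutionOfSingularities.ResolutionOfSingularities.Theorems.DeltaCutStellarCarve

/-!
# StellarCut T8 — «TameCut»: the hypersurface-shape n.c. law `WORNCHyp n` split by the RESIDUE OF THE MARKING, TAME (`p ∤ n`) /
# WILD (`p ∣ n`)  (lens-6, g32 → g33 letters; 0-weight)

`DeltaCutStellarCells` (T2) typed the hypersurface-shape n.c. law `WORNCHyp n` (weak resolution for every base `n`-datum whose stage
is a HYPERSURFACE-SHAPE labelled n.c. square-contact stage, `IsNCHypStage n`: stalk-locally `𝓘_y = (hⁿ + u·m)`, `u` a unit, `(h)` the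
contact hypersurface `H`, `(m)` the labelled boundary monomial, frame snc, `Supp ⊆ H`) and recorded why the face law of `WORNC` does
not transfer: at a LABEL-`0` BIRTH (a face of weight exactly `n` is blown up) the top locus may leave `H′` inside the new exceptional
divisor (the kangaroo `x² + (1 + xz)·z²w²`, `n = 2 = p`).

THE FAULT LINE IS THE RESIDUE OF `n` MODULO `p` (desk, first-order derivation guard; lens-6 NEXT-g33 «TameCut»).  Blow up a face
`C = H ∩ ⋂_{j∈T} D_j` of weight `w = Σ_T a_j ≥ n`.  In a `D_j`-chart at a point `y′` of the exceptional divisor off `H′` the controlled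
transform is `h′ⁿ + (π*u)·z_j^{w−n}·μ̃` with `h′(y′) ≠ 0` and `∂_{h′}(π*u) = z_j·(…) = 0` on `E`, so for `w = n` its `h′`-derivative at
`y′` is `n·h′(y′)ⁿ⁻¹` — a unit as soon as `p ∤ n`; in the `H`-chart it is `1 + (π*u)·h^{w−n}·μ`, `μ = Π_T ξ_j^{a_j}·Π_{l∉T} z_l^{a_l}`,
with `∂_{ξ_j}(π*u) = h·(…) = 0` on `E`, so for `w = n` its `ξ_j`-derivative at a zero `y′ ∈ E` is `u(y₀)·a_j·μ(y′)/ξ_j(y′)` — a unit for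
some `j ∈ T` because `p ∤ n = Σ_T a_j`.  Hence for `p ∤ n` every round of the face strategy keeps `Supp ⊆ H′` (no kangaroo), keeps the
hypersurface shape (`u ↦ π*u·(units)`), keeps snc, and the measure of `DeltaCutStellarStrategy` (T5) runs verbatim: the TAME cell
below is ATTACKABLE by the landed machinery plus a chart-algebra round lemma; the WILD cell (`p ∣ n`: in the terminal phase a
weight-`n` face all of whose labels are `≡ 0 (mod p)` meets no other positively-labelled divisor, so no admissible centre inside it
makes progress and the birth is forced) is exactly the purely-inseparable-marking regime of the kangaroo and of D₀'s companions
(`n = 2 = p`) — IDEA-NEEDED (frame change), not claimed.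

THIS FILE (letters and pure logic only): `WORNCHypTame n` / `WORNCHypWild n` (binders of `WORNCHyp n` VERBATIM plus the residue
condition `¬ p ∣ n` / `p ∣ n`), the EXACT carve `worNCHyp_iff_tame_wild`, the vacuous `worNCHypWild_one`, the families
`E1NCHypTame` / `E1NCHypWild` with `e1NCHyp_iff_tame_wild`, and the edges into the T7 carve:
`E1NCHypTame → E1NCHypWild → E1NCEntryPerpetual → E1TopSFrozenOffNC → E1TopSHeavy / E1TopGHeavy / E1TopNoAbs / E 1`.
0 sorry; axioms standard. [new] [folklore]
-/

noncomputable section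

open CategoryTheory CategoryTheory.Limits AlgebraicGeometry TopologicalSpace IsLocalRing
open Literature.AlgebraicGeometry.Resolution

namespace Summit.ResolutionOfSingularities.ResolutionOfSingularities.Theorems.DeltaCutClasses

open Summit.ResolutionOfSingularities.ResolutionOfSingularities.Theorems
open WeakOrderReduction ForcedTowerClasses

section TameCells

open SubfieldContactClasses

/-- **THE TAME HYPERSURFACE-SHAPE N.C. LAW · `WORNCHypTame n`** — `WORNCHyp n` restricted to characteristics NOT dividing the
marking (binders of `WORNCHyp n` VERBATIM, plus `¬ p ∣ n` after the base).  UNDECIDED · ATTACKABLE: the first-order derivation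
guard (module docstring) keeps `Supp ⊆ H′` through every face round incl. label-`0` births, so the T5 face strategy applies once the
hypersurface-shape round lemma (chart algebra) is typed.  Contains every hypersurface-shape n.c. datum with `p ∤ n`
(e.g. `x³ + (1 + xz)·z³w³` in characteristic `2`). -/
def WORNCHypTame (n : ℕ) : Prop :=
  ∀ p : ℕ, p.Prime → ∀ (k : Type) [Field k] [CharP k p] (Y : Scheme.{0}) (g : Y ⟶ Spec (.of k)),
    IsBase Y g → ¬ p ∣ n → ∀ M : MarkedIdeal Y, IsDatum n M → IsNCHypStage n ⟨Y, M.ideal⟩ → ∃ t : CentreSeq Y, WeakResolution t M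

/-- **THE WILD HYPERSURFACE-SHAPE N.C. LAW · `WORNCHypWild n`** — `WORNCHyp n` restricted to characteristics DIVIDING the marking
(binders of `WORNCHyp n` VERBATIM, plus `p ∣ n` after the base).  UNDECIDED · IDEA-NEEDED: the purely-inseparable-marking regime —
weight-`n` faces all of whose labels are divisible by `p` are forced centres in the terminal phase and their births CAN move the top
locus off `H′` (the kangaroo `x² + (1 + xz)·z²w²`, `n = 2 = p`; the hypersurface companions `x² + t·z⁶w⁶` of D₀; T₃ = `z³ + (tuw)⁴` in
characteristic `3`).  A frame-change theory is needed; NOT claimed to lie outside Narasimhan's barrier. -/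
def WORNCHypWild (n : ℕ) : Prop :=
  ∀ p : ℕ, p.Prime → ∀ (k : Type) [Field k] [CharP k p] (Y : Scheme.{0}) (g : Y ⟶ Spec (.of k)),
    IsBase Y g → p ∣ n → ∀ M : MarkedIdeal Y, IsDatum n M → IsNCHypStage n ⟨Y, M.ideal⟩ → ∃ t : CentreSeq Y, WeakResolution t M

/-- **EXACT CARVE by the residue of the marking** (hypothesis-free, excluded middle on `p ∣ n`):
`WORNCHyp n ⟺ WORNCHypTame n ∧ WORNCHypWild n`. [new] [folklore] -/
theorem worNCHyp_iff_tame_wild (n : ℕ) : WORNCHyp n ↔ WORNCHypTame n ∧ WORNCHypWild n := by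
  constructor
  · intro h
    exact ⟨fun p hp k _ _ Y g hB _ M hM hS => h p hp k Y g hB M hM hS,
      fun p hp k _ _ Y g hB _ M hM hS => h p hp k Y g hB M hM hS⟩
  · rintro ⟨hT, hW⟩ p hp k _ _ Y g hB M hM hS
    by_cases hd : p ∣ n
    · exact hW p hp k Y g hB hd M hM hS
    · exact hT p hp k Y g hB hd M hM hS

/-- the two cells recover the law: `WORNCHypTame n → WORNCHypWild n → WORNCHyp n`. [new] [folklore] -/
theorem worNCHyp_of_tame_wild {n : ℕ} (hT : WORNCHypTame n) (hW : WORNCHypWild n) : WORNCHyp n :=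
  (worNCHyp_iff_tame_wild n).2 ⟨hT, hW⟩

/-- sanity: at marking `1` the wild cell is VACUOUS (no prime divides `1`). [new] [folklore] -/
theorem worNCHypWild_one : WORNCHypWild 1 :=
  fun _ hp _ _ _ _ _ _ hd _ _ _ => absurd (Nat.dvd_one.mp hd ▸ hp) Nat.not_prime_one

/-- per level: the n.c.-regime part of the residual from the two hypersurface cells,
`WORNCHypTame n → WORNCHypWild n → WORTopSHeavyNC n` (`WORNC n` discharged by `worNC_holds`). [new] -/
theorem worTopSHeavyNC_of_tame_wild {n : ℕ} (hn : 1 ≤ n) (hT : WORNCHypTame n) (hW : WORNCHypWild n) : WORTopSHeavyNC n :=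
  worTopSHeavyNC_of_hyp hn (worNCHyp_of_tame_wild hT hW)

/-- the family of tame hypersurface-shape n.c. laws, all markings `n ≥ 1`. -/
def E1NCHypTame : Prop := ∀ n : ℕ, 1 ≤ n → WORNCHypTame n

/-- the family of wild hypersurface-shape n.c. laws, all markings `n ≥ 1`. -/
def E1NCHypWild : Prop := ∀ n : ℕ, 1 ≤ n → WORNCHypWild n

/-- families, exact carve: `E1NCHyp ⟺ E1NCHypTame ∧ E1NCHypWild`. [new] [folklore] -/
theorem e1NCHyp_iff_tame_wild : E1NCHyp ↔ E1NCHypTame ∧ E1NCHypWild :=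
  ⟨fun h => ⟨fun n hn => ((worNCHyp_iff_tame_wild n).1 (h n hn)).1, fun n hn => ((worNCHyp_iff_tame_wild n).1 (h n hn)).2⟩,
    fun h n hn => (worNCHyp_iff_tame_wild n).2 ⟨h.1 n hn, h.2 n hn⟩⟩

/-- families: `E1NCHypTame → E1NCHypWild → E1NCHyp`. [new] [folklore] -/
theorem e1NCHyp_of_tame_wild (hT : E1NCHypTame) (hW : E1NCHypWild) : E1NCHyp :=
  e1NCHyp_iff_tame_wild.2 ⟨hT, hW⟩

/-- **THE CARVE AFTER `WORNC`, HYPERSURFACE SIDE SPLIT BY RESIDUE**: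
`E1NCHypTame → E1NCHypWild → E1NCEntryPerpetual → E1TopSFrozenOffNC → E1TopSHeavy`. [new] -/
theorem e1TopSHeavy_of_tame_wild (hT : E1NCHypTame) (hW : E1NCHypWild) (hE : E1NCEntryPerpetual)
    (hO : E1TopSFrozenOffNC) : E1TopSHeavy :=
  e1TopSHeavy_of_ncHyp (e1NCHyp_of_tame_wild hT hW) hE hO

/-- exact remainder form: `E1NCHypTame → E1NCHypWild → E1TopSHeavyOffNC → E1TopSHeavy`. [new] -/
theorem e1TopSHeavy_of_tame_wild_offNC (hT : E1NCHypTame) (hW : E1NCHypWild) (hO : E1TopSHeavyOffNC) : E1TopSHeavy :=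
  e1TopSHeavy_of_ncHyp_offNC (e1NCHyp_of_tame_wild hT hW) hO

/-- edge to the live aside (item 27045): under `E 5`,
`E1NCHypTame → E1NCHypWild → E1NCEntryPerpetual → E1TopSFrozenOffNC → E1TopGHeavy`. [new] -/
theorem e1TopGHeavy_of_tame_wild (h5 : E 5) (hT : E1NCHypTame) (hW : E1NCHypWild) (hE : E1NCEntryPerpetual)
    (hO : E1TopSFrozenOffNC) : E1TopGHeavy :=
  e1TopGHeavy_of_ncHyp h5 (e1NCHyp_of_tame_wild hT hW) hE hO

/-- edge to the column item (26971): under `SubfieldContactAbs` and `E 5`,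
`E1NCHypTame → E1NCHypWild → E1NCEntryPerpetual → E1TopSFrozenOffNC → E1TopNoAbs`. [new] -/
theorem e1TopNoAbs_of_tame_wild (hSC : SubfieldContactAbs) (h5 : E 5) (hT : E1NCHypTame) (hW : E1NCHypWild)
    (hE : E1NCEntryPerpetual) (hO : E1TopSFrozenOffNC) : E1TopNoAbs :=
  e1TopNoAbs_of_ncHyp hSC h5 (e1NCHyp_of_tame_wild hT hW) hE hO

/-- summit edge of the column: under `SubfieldContactAbs` and `E 5`,
`E1NCHypTame → E1NCHypWild → E1NCEntryPerpetual → E1TopSFrozenOffNC → E 1`. [new] -/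
theorem e_one_of_tame_wild (hSC : SubfieldContactAbs) (h5 : E 5) (hT : E1NCHypTame) (hW : E1NCHypWild)
    (hE : E1NCEntryPerpetual) (hO : E1TopSFrozenOffNC) : E 1 :=
  e_one_of_ncHyp hSC h5 (e1NCHyp_of_tame_wild hT hW) hE hO

end TameCells

end Summit.ResolutionOfSingularities.ResolutionOfSingularities.Theorems.DeltaCutClasses
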